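import Summits.QuantumFields.YangMills.Theorems.BalabanUVNodesN15KingModelCovariantBlockRoughWitness
import Literature.MathematicalPhysics.QuantumFieldTheory.King1986.UniformDecay
import HarnessLib

/-!
# BalabanUVNodes ∕ N15 — THE KING-MODEL RUNG (PART Ϥ-g): THE `η`-UNIFORM FLOOR AT FLAT FIELDS — at `U ≡ 1` the full operator `A₀(1) = L²(−Δ) + m² + aQ^*Q` is KING's `fineOp` ⊗ 1 and
# inherits the tree's DIMOCK–LEMMA-29 COERCIVITY `γ_A = gamA a (d+1)` INDEPENDENT OF `L`, the volume and the mass (`King1986.Torus.fineOp_coercive_unif`, BY NAME); by PART Ϥ-d's gauge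
# covariance the same `L`-uniform floor holds at EVERY PURE GAUGE `U = g(x)g(x+e_μ)^*`: `γ_A·Σ‖v_x‖² ≤ Re⟨v,A₀(U)v⟩`, `‖G(U)‖ ≤ γ_A⁻¹` for all `L` — contrast PART Ϥ-f (rough fields: `Θ(η^d)`)
# (Track A, DAG node N15 = NE2; FAN-OUT v1.1 §N15 s3 «KING-MODEL RUNG … + what the curved case adds»; count-neutral)

HONEST FRAMING.  Count-neutral (cell `pub-ymgap`, seat `pub-ymgap-dag-n15-e` g49; `--supports stmt-QuantumFields-27247 --as helper` = K3ᴬ, KEY MAP v3).  King's comparison model in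
King's scaling `c = L² = η⁻²` (unit blocks; tree `fineOp N M a (N²) m²`); the `L`-uniform constant is the tree's `gamA a (d+1) = min(4c₀∕(c₀+4), ac₀∕4)`, `c₀ = (4∕π²)^{d+1}`
([Dimock2013] App. D Lemma 29 as landed in `King1986.UniformDecay`).  Flat fields with trivial holonomy only (pure gauges); torons and curved fields are NOT covered here (PART Ϥ-h treats
small-field gauges).  NOT Bałaban's multi-level `G_k(U)`; NOT (3.42); NOT a node discharge (N15 of record untouched); nothing continuum ∕ ℝ⁴ ∕ OS ∕ Clay.

RESULTS.  §1 (generic) ★ `re_quadForm_realKron_ge`: a real matrix `A` on `T` with `γ(y⬝y) ≤ y⬝Ay` gives `γΣ_x‖v_x‖² ≤ Re⟨v,Bv⟩` for the `𝕜`-matrix `B((x,i),(x′,k)) = A(x,x′)δ_{ik}` on `T × n`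
(split `v` into real and imaginary parts colourwise); §2 ★★ `fullOpU_const_one_apply` (`A₀(1)((x,i),(x′,k)) = fineOp L M a c m² (x,x′)·δ_{ik}`: Ͱ-a `covLapF_free_eq_kronecker` + Ϥ-d
`blockProjU_const_one_apply_eq_blockProj`); §3 ★★★ **`re_quadForm_fullOpU_const_one_ge_gamA`** (`γ_A·Σ‖v_x‖² ≤ Re⟨v,A₀(1)v⟩` with `c = L²`, `L ≥ 1`, `a, m² ≥ 0` — King's ∕ Dimock's
Lemma 29 BY NAME, `L`-UNIFORM), ★★★ **`re_quadForm_fullOpU_pureGauge_ge_gamA`** (the same at every pure gauge `U = kingGaugeAct g 1`, Ϥ-d `coercive_fullOpU_kingGaugeAct`), ★★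
`posDef_fullOpU_pureGauge_massless`, ★★★ **`l2_opNorm_fullOpU_pureGauge_massless_inv_le`** (`‖(L²(−Δ_U) + aQ(U)^*Q(U))⁻¹‖ ≤ γ_A⁻¹` at every pure gauge, every `L ≥ 1`, every volume —
the η-UNIFORM bound that PART Ϥ-f shows to fail over rough fields), ★★ `king_flat_vs_rough` (both facts side by side: at pure gauges every eigenvalue `≥ γ_A` for all `L`; at the rough
witness some eigenvalue `≤ 4π²L^{−d}`).
PRIOR TREE ART (by name): `King1986.Torus` (`fineOp`, `fineOp_coercive_unif`, `gamA`, `gamA_pos`, `blockProj`, `lapF`), `QGQInverse.Coercive`, Ͱ-a (`covLapF_free_eq_kronecker`, `kingGaugeAct`,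
`kingGaugeAct_mem_unitaryGroup`), Ϥ-d (`fullOpU`, `fullOpU_eq`, `blockProjU_const_one_apply_eq_blockProj`, `isHermitian_fullOpU`, `coercive_fullOpU_kingGaugeAct`), Ϥ-e∕Ϡ-i engines
(`eigenvalues_ge_of_coercive'`, `posDef_of_coercive'`, `l2_opNorm_inv_le_of_coercive'`), Ϥ-f (`exists_eigenvalue_fullOpU_spineFluxLink_le` — cited in the docstring only).  Dedup (rg at filing):
basename 0 files; needles `re_quadForm_realKron_ge|fullOpU_const_one_apply|pureGauge_ge_gamA` 0 files in `Summits/QuantumFields/YangMills` + `Literature/MathematicalPhysics`.  presearch: n/a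
(composition of in-tree theorems).  Locators: [King1986] (2.13) p.653, (4.5) p.670, (4.33)–(4.37) p.674; [Dimock2013] App. D Lemma 29; [Balaban1985BackgroundPropagators] (3.34) p.396, p.395 l.1–3.  0 `sorry`, 0 `def`.
-/

noncomputable section
open scoped BigOperators ComplexConjugate ComplexOrder Matrix.Norms.L2Operator Kronecker
open Finset Matrix WithLp

namespace Summit.QuantumFields.YangMills.BalabanUVNodes.N15KingModelRung.CovariantBlock

open Literature.MathematicalPhysics.QuantumFieldTheory.Balaban1983to89 (QGQInverse.Coercive)
open Literature.MathematicalPhysics.QuantumFieldTheory.Balaban1983to89.B5Prop11Plancherel (Tor fine unitVec)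
open Literature.MathematicalPhysics.QuantumFieldTheory.LatticeDiamagneticInequality (Hopping)
open Literature.MathematicalPhysics.QuantumFieldTheory.King1986.Torus (site blockProj lapF fineOp fineOp_coercive_unif gamA gamA_pos)
open Summit.QuantumFields.YangMills.BalabanUVNodes.N15KingModelRung.Covariant (covLapF covLapF_free_eq_kronecker kingGaugeAct kingGaugeAct_mem_unitaryGroup fib fib_apply sum_norm_fib_sq)
open Summit.QuantumFields.YangMills.BalabanUVNodes.N15KingModelRung.Landau (eigenvalues_ge_of_coercive' posDef_of_coercive' l2_opNorm_inv_le_of_coercive')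

variable {d : ℕ} {L : ℕ} [NeZero L] (T : BlockTree d L) (M : Fin (d + 1) → ℕ) [hM : ∀ μ, NeZero (M μ)]
variable {𝕜 : Type*} [RCLike 𝕜] {n : Type*} [Fintype n] [DecidableEq n]

/-! ## §1 Real coercivity passes to the colour-diagonal complexification -/

section Generic

variable (K : Fin (d + 1) → ℕ) [hK : ∀ μ, NeZero (K μ)]

omit hM hK [DecidableEq n] in
/-- `‖v_x‖² = Σ_i (re v(x,i))² + Σ_i (im v(x,i))²`. [folklore] -/
theorem norm_fib_sq_eq_re_im (v : Tor K × n → 𝕜) (x : Tor K) :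
    ‖fib K v x‖ ^ 2 = ∑ i, (RCLike.re (v (x, i)) ^ 2 + RCLike.im (v (x, i)) ^ 2) := by
  rw [EuclideanSpace.norm_sq_eq]
  refine Finset.sum_congr rfl fun i _ => ?_
  rw [fib_apply, RCLike.norm_sq_eq_def]; ring

omit hM in
/-- ★ **REAL COERCIVITY ⟹ COERCIVITY OF THE COLOUR-DIAGONAL EXTENSION**: if a real matrix `A` on the sites satisfies `γ·(y⬝y) ≤ y⬝(Ay)` for all real `y`, then the `𝕜`-matrix
`B((x,i),(x′,k)) = A(x,x′)·δ_{ik}` satisfies `γ·Σ_x‖v_x‖² ≤ Re⟨v,Bv⟩` for all `v : T × n → 𝕜` (apply the real bound to `re v(·,i)` and `im v(·,i)` for each colour `i`). [folklore] -/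
theorem re_quadForm_realKron_ge {A : Matrix (Tor K) (Tor K) ℝ} {γ : ℝ} (hA : QGQInverse.Coercive A γ) {B : Matrix (Tor K × n) (Tor K × n) 𝕜}
    (hB : ∀ x i x' k, B (x, i) (x', k) = ((A x x' : ℝ) : 𝕜) * (1 : Matrix n n 𝕜) i k) (v : Tor K × n → 𝕜) :
    γ * ∑ x, ‖fib K v x‖ ^ 2 ≤ RCLike.re (star v ⬝ᵥ (B *ᵥ v)) := by
  -- the real and imaginary colour components
  set vr : n → Tor K → ℝ := fun i x => RCLike.re (v (x, i)) with hvr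
  set vi : n → Tor K → ℝ := fun i x => RCLike.im (v (x, i)) with hvi
  have hform : RCLike.re (star v ⬝ᵥ (B *ᵥ v)) = ∑ i, (vr i ⬝ᵥ (A *ᵥ vr i) + vi i ⬝ᵥ (A *ᵥ vi i)) := by
    simp only [dotProduct, Matrix.mulVec, map_sum, Fintype.sum_prod_type, Finset.mul_sum]
    -- Σ_x Σ_i Σ_x' Σ_k re(conj v(x,i) · B(x,i)(x',k) v(x',k))
    rw [Finset.sum_comm]
    refine Finset.sum_congr rfl fun i _ => ?_
    rw [← Finset.sum_add_distrib]
    refine Finset.sum_congr rfl fun x _ => ?_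
    rw [← Finset.sum_add_distrib]
    refine Finset.sum_congr rfl fun x' _ => ?_
    rw [Finset.sum_eq_single i]
    · rw [hB, Matrix.one_apply_eq, mul_one, Pi.star_apply, RCLike.star_def]
      simp only [hvr, hvi]
      rw [RCLike.mul_re, RCLike.conj_re, RCLike.conj_im, RCLike.re_ofReal_mul, RCLike.im_ofReal_mul]
      ring
    · intro k _ hk
      rw [hB, Matrix.one_apply_ne (Ne.symm hk), mul_zero, zero_mul, mul_zero, map_zero]
    · intro h; exact absurd (Finset.mem_univ i) h
  have hmass : ∑ x, ‖fib K v x‖ ^ 2 = ∑ i, (vr i ⬝ᵥ vr i + vi i ⬝ᵥ vi i) := by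
    simp only [dotProduct, hvr, hvi, ← Finset.sum_add_distrib]
    rw [Finset.sum_comm]
    refine Finset.sum_congr rfl fun x _ => ?_
    rw [norm_fib_sq_eq_re_im]
    refine Finset.sum_congr rfl fun i _ => ?_
    ring
  rw [hform, hmass, Finset.mul_sum]
  exact Finset.sum_le_sum fun i _ => by rw [mul_add]; exact add_le_add (hA (vr i)) (hA (vi i))

end Generic

/-! ## §2 `A₀(1)` is King's `fineOp` on every colour -/

/-- ★★ **AT `U ≡ 1` THE FULL OPERATOR IS KING's `fineOp ⊗ 1`**: `A₀(1)((x,i),(x′,k)) = (lapF + a·blockProj)(x,x′)·δ_{ik}` (PART Ͱ-a `covLapF_free_eq_kronecker` and PART Ϥ-d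
`blockProjU_const_one_apply_eq_blockProj`). [cite: King1986, (2.13) p.653, (4.5) p.670] -/
theorem fullOpU_const_one_apply (a c m2 : ℝ) (x : Tor (fine L M)) (i : n) (x' : Tor (fine L M)) (k : n) :
    fullOpU T M a c m2 (fun _ => (1 : Matrix n n 𝕜)) (x, i) (x', k) = ((fineOp L M a c m2 x x' : ℝ) : 𝕜) * (1 : Matrix n n 𝕜) i k := by
  rw [fullOpU_eq, Matrix.add_apply, Matrix.smul_apply, blockProjU_const_one_apply_eq_blockProj, smul_eq_mul,
    show (fun _ : Tor (fine L M) × Fin (d + 1) => (1 : Matrix n n 𝕜)) = (Hopping.free : Tor (fine L M) × Fin (d + 1) → Matrix n n 𝕜) from rfl,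
    covLapF_free_eq_kronecker, Matrix.kroneckerMap_apply, Matrix.map_apply, fineOp, Matrix.add_apply, Matrix.smul_apply, smul_eq_mul]
  push_cast; ring

/-! ## §3 The `L`-uniform floor at `U ≡ 1` and at pure gauges -/

/-- ★★★ **KING's ∕ DIMOCK's `L`-UNIFORM FLOOR AT `U ≡ 1`** (BY NAME: tree `King1986.Torus.fineOp_coercive_unif`, [Dimock2013] Lemma 29): in King's scaling `c = L²`, for `L ≥ 1`, `a ≥ 0`, `m² ≥ 0`,
every tree contour system and every fibre: `γ_A·Σ_x‖v_x‖² ≤ Re⟨v, A₀(1)v⟩`, `γ_A = gamA a (d+1)` INDEPENDENT of `L`, `M`, `m²`. [cite: King1986, (4.33)–(4.37) p.674; Dimock2013, App. D Lemma 29] -/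
theorem re_quadForm_fullOpU_const_one_ge_gamA (hL : 1 ≤ L) {a m2 : ℝ} (ha : 0 ≤ a) (hm : 0 ≤ m2) (v : Tor (fine L M) × n → 𝕜) :
    gamA a (d + 1) * ∑ x, ‖fib (fine L M) v x‖ ^ 2 ≤ RCLike.re (star v ⬝ᵥ (fullOpU T M a ((L : ℝ) ^ 2) m2 (fun _ => (1 : Matrix n n 𝕜)) *ᵥ v)) :=
  re_quadForm_realKron_ge (fine L M) (fineOp_coercive_unif L M hL ha hm) (fun x i x' k => fullOpU_const_one_apply T M a _ m2 x i x' k) v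

/-- ★★★ **THE SAME `L`-UNIFORM FLOOR AT EVERY PURE GAUGE** `U = g(x)·1·g(x+e_μ)^*` (flat, trivial holonomy): `γ_A·Σ_x‖v_x‖² ≤ Re⟨v, A₀(U)v⟩` (PART Ϥ-d gauge covariance (3.34)).
[cite: Balaban1985BackgroundPropagators, (3.34) p.396, p.395 l.1–3; King1986, (4.33) p.674; Dimock2013, App. D Lemma 29] -/
theorem re_quadForm_fullOpU_pureGauge_ge_gamA (hL : 1 ≤ L) {a m2 : ℝ} (ha : 0 ≤ a) (hm : 0 ≤ m2) {g : Tor (fine L M) → Matrix n n 𝕜} (hg : ∀ x, g x ∈ Matrix.unitaryGroup n 𝕜)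
    (v : Tor (fine L M) × n → 𝕜) :
    gamA a (d + 1) * ∑ x, ‖fib (fine L M) v x‖ ^ 2 ≤ RCLike.re (star v ⬝ᵥ (fullOpU T M a ((L : ℝ) ^ 2) m2 (kingGaugeAct (fine L M) g fun _ => (1 : Matrix n n 𝕜)) *ᵥ v)) :=
  coercive_fullOpU_kingGaugeAct T M a _ m2 hg (re_quadForm_fullOpU_const_one_ge_gamA T M hL ha hm) v

omit [NeZero L] hM in
/-- Pure gauges are unitary link fields. [folklore] -/
theorem pureGauge_mem_unitaryGroup {g : Tor (fine L M) → Matrix n n 𝕜} (hg : ∀ x, g x ∈ Matrix.unitaryGroup n 𝕜) (bd : Tor (fine L M) × Fin (d + 1)) :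
    kingGaugeAct (fine L M) g (fun _ => (1 : Matrix n n 𝕜)) bd ∈ Matrix.unitaryGroup n 𝕜 :=
  kingGaugeAct_mem_unitaryGroup (fine L M) hg (fun _ => Submonoid.one_mem _) bd

/-- ★★ Every eigenvalue of `A₀(U)` at a pure gauge is `≥ γ_A`, for every `L ≥ 1`. [cite: King1986, (4.33) p.674; Dimock2013, App. D Lemma 29; HornJohnson2013, Thm 4.2.2] -/
theorem eigenvalues_fullOpU_pureGauge_ge_gamA (hL : 1 ≤ L) {a m2 : ℝ} (ha : 0 ≤ a) (hm : 0 ≤ m2) {g : Tor (fine L M) → Matrix n n 𝕜} (hg : ∀ x, g x ∈ Matrix.unitaryGroup n 𝕜)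
    (i : Tor (fine L M) × n) :
    gamA a (d + 1) ≤ (isHermitian_fullOpU T M a ((L : ℝ) ^ 2) m2 (kingGaugeAct (fine L M) g fun _ => (1 : Matrix n n 𝕜))).eigenvalues i :=
  eigenvalues_ge_of_coercive' (fine L M) (isHermitian_fullOpU T M a _ m2 _) (re_quadForm_fullOpU_pureGauge_ge_gamA T M hL ha hm hg) i

/-- ★★ THE MASSLESS FULL OPERATOR AT A PURE GAUGE IS POSITIVE DEFINITE with the `L`-uniform margin `γ_A` (`a > 0`). [cite: King1986, (4.33) p.674; Dimock2013, App. D Lemma 29] -/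
theorem posDef_fullOpU_pureGauge_massless (hL : 1 ≤ L) {a : ℝ} (ha : 0 < a) {g : Tor (fine L M) → Matrix n n 𝕜} (hg : ∀ x, g x ∈ Matrix.unitaryGroup n 𝕜) :
    (fullOpU T M a ((L : ℝ) ^ 2) 0 (kingGaugeAct (fine L M) g fun _ => (1 : Matrix n n 𝕜))).PosDef :=
  posDef_of_coercive' (fine L M) (isHermitian_fullOpU T M a _ 0 _) (gamA_pos ha (d + 1)) (re_quadForm_fullOpU_pureGauge_ge_gamA T M hL ha.le le_rfl hg)

/-- ★★★ **THE `η`-UNIFORM BOUND ON THE MASSLESS FULL PROPAGATOR AT PURE GAUGES**: `‖(L²(−Δ_U) + aQ(U)^*Q(U))⁻¹‖ ≤ γ_A⁻¹` for every pure gauge `U`, every `L ≥ 1` and every volume —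
ONE constant for all lattice spacings `η = L⁻¹` (contrast PART Ϥ-f: over ROUGH fields the best `U`-uniform constant is `Θ(L^d)`).
[cite: King1986, (2.13) p.653, (4.33) p.674; Dimock2013, App. D Lemma 29; Balaban1985BackgroundPropagators, p.395 l.1–3] -/
theorem l2_opNorm_fullOpU_pureGauge_massless_inv_le (hL : 1 ≤ L) {a : ℝ} (ha : 0 < a) {g : Tor (fine L M) → Matrix n n 𝕜} (hg : ∀ x, g x ∈ Matrix.unitaryGroup n 𝕜) :
    ‖(fullOpU T M a ((L : ℝ) ^ 2) 0 (kingGaugeAct (fine L M) g fun _ => (1 : Matrix n n 𝕜)))⁻¹‖ ≤ (gamA a (d + 1))⁻¹ :=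
  l2_opNorm_inv_le_of_coercive' (fine L M) (isHermitian_fullOpU T M a _ 0 _) (gamA_pos ha (d + 1)) (re_quadForm_fullOpU_pureGauge_ge_gamA T M hL ha.le le_rfl hg)

/-- ★★ **FLAT VERSUS ROUGH, SIDE BY SIDE** (comb contours, `L ≥ 2`, `a > 0`, King's scaling `c = L²`, massless, non-trivial fibre `ℂⁿ`): at every pure gauge ALL eigenvalues of
`L²(−Δ_U) + aQ(U)^*Q(U)` are `≥ γ_A` (no `L`); at PART Ϥ-f's rough witness SOME eigenvalue is `≤ 4π²·L^{−d}` (`→ 0`).  The `η`-uniform positivity of the full propagator is a property of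
REGULAR fields. [cite: Balaban1985BackgroundPropagators, p.395 l.1–3, (3.35) p.396; King1986, (4.33) p.674; Dimock2013, App. D Lemma 29] -/
theorem king_flat_vs_rough {n : Type*} [Fintype n] [DecidableEq n] [Nonempty n] (hL : 2 ≤ L) {a : ℝ} (ha : 0 < a) :
    (∀ g : Tor (fine L M) → Matrix n n ℂ, (∀ x, g x ∈ Matrix.unitaryGroup n ℂ) →
        ∀ i, gamA a (d + 1) ≤ (isHermitian_fullOpU (kingComb d L) M a ((L : ℝ) ^ 2) 0 (kingGaugeAct (fine L M) g fun _ => (1 : Matrix n n ℂ))).eigenvalues i)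
      ∧ ∃ U : Tor (fine L M) × Fin (d + 1) → Matrix n n ℂ, (∀ bd, U bd ∈ Matrix.unitaryGroup n ℂ) ∧
        ∃ i, (isHermitian_fullOpU (kingComb d L) M a ((L : ℝ) ^ 2) 0 U).eigenvalues i ≤ 4 * Real.pi ^ 2 / (L : ℝ) ^ d := by
  refine ⟨fun g hg i => eigenvalues_fullOpU_pureGauge_ge_gamA (kingComb d L) M (by omega) ha.le le_rfl hg i, ?_⟩
  obtain ⟨U, hU, i, hi⟩ := (king_full_propagator_floor_two_sided M (n := n) hL (c := (L : ℝ) ^ 2) (by positivity) a 0).2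
  refine ⟨U, hU, i, hi.trans_eq ?_⟩
  have hL0 : (L : ℝ) ≠ 0 := by exact_mod_cast NeZero.ne L
  rw [zero_add]; field_simp; ring

end Summit.QuantumFields.YangMills.BalabanUVNodes.N15KingModelRung.CovariantBlock

end
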